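import Literature.Probability.LatticeModels.CoarseCellMixingRecursion
import HarnessLib

/-!
# The coarse-cell block recursion: base step, and exponential decay in the pure case

Fourth companion ("theorems only") file of
`Literature/Probability/LatticeModels/CoarseCellFiniteSize.lean`: the Dobrushin–Shlosman block
recursion in sup form for a specification with the good-exterior finite-size condition at
`(n, ε)`, NO bad configurations and exact range `2n+1` (`HasLeak … n 0 r`), on a coarse torus with
`≥ 4n+3` cells per side:

* `fs_base_step` — the first rung of the block recursion: two boundary conditions agreeing on
  the cube of radius `2n` around `c` off the volume `Λ` and good near `c` off `Λ` move the kernel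
  expectation `γ_Λ f` of a `[0,1]`-valued cell-`c`-local `f` by at most `ε` plus the two kernel
  probabilities that a SHELL cell (`cdist = 2n+1`) meeting `Λ` is bad (resample the block
  `Λ ∩ cube`, freeze it, apply the finite-size condition pointwise on the good event);
* `pure_influence_decay` — boundary conditions agreeing off `Λ` on the ball of radius
  `2n + k(2n+1)` around `x` move single-cell expectations by `≤ ε (ε · shellCount d n)^k`
  (resample the cube, project onto the shell cells, normalise the block expectation to `[0,1]`
  using that all its values lie in an interval of length `ε`, chain rule `multiCell_influence`);
  (the averaged consequence `pure_core_bound` and the covariance bound are in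
  `CoarseCellMixingPure.lean`).

## References

* R. L. Dobrushin, S. B. Shlosman, *Constructive criterion for the uniqueness of Gibbs field*
  (1985), §2.
* J. van den Berg, C. Maes, Ann. Probab. 22 (1994), Thm. 1 and Cor. 1.
* H.-O. Georgii, *Gibbs Measures and Phase Transitions*, 2nd ed. (de Gruyter 2011), §8.2.
-/

noncomputable section

open _root_.MeasureTheory
open scoped ENNReal

namespace Literature.Probability.LatticeModels

variable {d : ℕ} {μc : Fin d → ℕ} {V S : Type*} [MeasurableSpace S]

/-- **Base step of the block recursion** (Dobrushin–Shlosman / van den Berg–Maes, first rung):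
if two boundary conditions `ζ, ζ'` agree on the cube of radius `2n` around `c` off `Λ` and are
good on every cell within `2n+1` of `c` that does not meet `Λ`, then the kernel expectations of
a `[0,1]`-valued cell-`c`-local `f` differ by at most `ε` plus the two kernel probabilities that
a SHELL cell (`cdist = 2n+1`) meeting `Λ` is bad. Proof: resample the block `A = Λ ∩ cube`
(`kernel_integral_integral_eq_of_subset`), freeze the spins of `A` at `ζ` inside the block
expectation (`DobrushinShlosman.spec_apply_congr`), and apply `IsGoodFS.fs` pointwise on the good event
(properness puts `ζ`, `ζ'` back off `Λ`). [cite: DobrushinShlosman1985, §2] -/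
theorem fs_base_step [Fintype V] {cell : V → CoarseIdx μc}
    {γ : Specification V S} (hγ : IsSpecification γ) {good : CoarseIdx μc → Set (V → S)}
    {n : ℕ} {ε : ℝ} (hε : 0 ≤ ε) (hFS : IsGoodFS cell γ good n ε) (c : CoarseIdx μc)
    (Λ : Finset V) (hΛ : ∀ v w, cell v = cell w → v ∈ Λ → w ∈ Λ) (ζ ζ' : V → S)
    (hagree : ∀ v, v ∉ Λ → cdist c (cell v) ≤ 2 * n → ζ v = ζ' v)
    (hgood : ∀ c', cdist c c' ≤ 2 * n + 1 → (∀ v, cell v = c' → v ∉ Λ) →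
      ζ ∈ good c' ∧ ζ' ∈ good c')
    {f : (V → S) → ℝ} (hf : Measurable f) (hf01 : ∀ σ, 0 ≤ f σ ∧ f σ ≤ 1)
    (hfdep : DependsOn f {v | cell v = c}) :
    |∫ σ, f σ ∂(γ Λ ζ) - ∫ σ, f σ ∂(γ Λ ζ')| ≤
      ε + (γ Λ ζ).real {σ | ∃ c', cdist c c' = 2 * n + 1 ∧ (∃ v ∈ Λ, cell v = c') ∧ σ ∉ good c'}
        + (γ Λ ζ').real
            {σ | ∃ c', cdist c c' = 2 * n + 1 ∧ (∃ v ∈ Λ, cell v = c') ∧ σ ∉ good c'} := by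
  classical
  set Bad : Set (V → S) :=
    {σ | ∃ c', cdist c c' = 2 * n + 1 ∧ (∃ v ∈ Λ, cell v = c') ∧ σ ∉ good c'} with hBad
  -- the resampled block `A = Λ ∩ cube(c, 2n)`
  set A : Finset V := Λ.filter fun v => cdist c (cell v) ≤ 2 * n with hA
  have hAΛ : A ⊆ Λ := Finset.filter_subset _ _
  have hAcube : ∀ v ∈ A, cdist c (cell v) ≤ 2 * n := fun v hv => (Finset.mem_filter.1 hv).2
  have hAunion : ∀ v w, cell v = cell w → v ∈ A → w ∈ A := fun v w hvw hv => by
    rw [hA, Finset.mem_filter] at hv ⊢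
    exact ⟨hΛ v w hvw hv.1, hvw ▸ hv.2⟩
  have hBadm : MeasurableSet Bad := measurableSet_badShell cell hFS.good_meas c n Λ
  -- the block expectation `φ = γ_A f`
  set φ : (V → S) → ℝ := fun σ => ∫ τ, f τ ∂(γ A σ) with hφ
  have hφm : Measurable φ := DobrushinShlosman.measurable_windowAvg' hγ A hf
  have hf1 : ∀ σ, |f σ| ≤ 1 := fun σ => by rw [abs_of_nonneg (hf01 σ).1]; exact (hf01 σ).2
  have hφ01 : ∀ σ, 0 ≤ φ σ ∧ φ σ ≤ 1 := fun σ => by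
    haveI := hγ.isProbability A σ
    exact integral_mem_unitInterval hf hf01
  have hφ1 : ∀ σ, |φ σ| ≤ 1 := fun σ => by rw [abs_of_nonneg (hφ01 σ).1]; exact (hφ01 σ).2
  have hφi : ∀ η, Integrable φ (γ Λ η) := fun η => by
    haveI := hγ.isProbability Λ η
    exact DobrushinMetric.integrable_of_abs_le' hφm hφ1
  -- resampling inside the kernel: `γ_Λ f = γ_Λ (γ_A f)`
  have hres : ∀ η, ∫ σ, f σ ∂(γ Λ η) = ∫ σ, φ σ ∂(γ Λ η) := fun η =>
    (kernel_integral_integral_eq_of_subset hγ hAΛ η hf hf1).symm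
  -- the pointwise good-exterior estimate
  have hkey : ∀ σ σ', (∀ x ∉ Λ, σ x = ζ x) → (∀ x ∉ Λ, σ' x = ζ' x) → σ ∉ Bad → σ' ∉ Bad →
      |φ σ - φ σ'| ≤ ε := by
    intro σ σ' hσ hσ' hσB hσ'B
    -- freeze the block `A` at `ζ` (the block kernel does not read it)
    let σh : V → S := fun v => if v ∈ A then ζ v else σ v
    let σh' : V → S := fun v => if v ∈ A then ζ v else σ' v
    have h1 : φ σ = φ σh := by
      simp only [hφ]
      rw [DobrushinShlosman.spec_apply_congr hγ A (ω := σ) (η := σh) fun x hx => by simp [σh, hx]]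
    have h2 : φ σ' = φ σh' := by
      simp only [hφ]
      rw [DobrushinShlosman.spec_apply_congr hγ A (ω := σ') (η := σh') fun x hx => by simp [σh', hx]]
    rw [h1, h2]
    refine hFS.fs c A hAcube hAunion σh σh' ?_ ?_ f hf hf01 hfdep
    · intro v hv
      by_cases hvA : v ∈ A
      · simp [σh, σh', hvA]
      · have hvΛ : v ∉ Λ := fun hvΛ => hvA (Finset.mem_filter.2 ⟨hvΛ, hv⟩)
        simp only [σh, σh', hvA, if_false]
        rw [hσ v hvΛ, hσ' v hvΛ]
        exact hagree v hvΛ hv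
    · intro c' hc' hc'A
      by_cases hmeet : ∃ v ∈ Λ, cell v = c'
      · -- a shell cell meeting `Λ`: goodness comes from `σ, σ' ∉ Bad`
        obtain ⟨v, hvΛ, hvc⟩ := hmeet
        have hdist : cdist c c' = 2 * n + 1 := by
          have hnot : ¬ cdist c (cell v) ≤ 2 * n := fun hle =>
            hc'A v hvc (Finset.mem_filter.2 ⟨hvΛ, hle⟩)
          rw [hvc] at hnot
          omega
        have hσg : σ ∈ good c' := by
          by_contra hng
          exact hσB ⟨c', hdist, ⟨v, hvΛ, hvc⟩, hng⟩
        have hσ'g : σ' ∈ good c' := by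
          by_contra hng
          exact hσ'B ⟨c', hdist, ⟨v, hvΛ, hvc⟩, hng⟩
        have e1 : σh ∈ good c' ↔ σ ∈ good c' :=
          hFS.good_local c' σh σ fun w hw => by simp [σh, hc'A w hw]
        have e2 : σh' ∈ good c' ↔ σ' ∈ good c' :=
          hFS.good_local c' σh' σ' fun w hw => by simp [σh', hc'A w hw]
        exact ⟨e1.2 hσg, e2.2 hσ'g⟩
      · -- a cell not meeting `Λ`: goodness of `ζ, ζ'` (properness puts them back)
        push Not at hmeet
        have hc'Λ : ∀ v, cell v = c' → v ∉ Λ := fun v hv hvΛ => hmeet v hvΛ hv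
        obtain ⟨hζg, hζ'g⟩ := hgood c' hc' hc'Λ
        have e1 : σh ∈ good c' ↔ ζ ∈ good c' :=
          hFS.good_local c' σh ζ fun w hw => by
            have hwΛ := hc'Λ w hw
            have hwA : w ∉ A := fun h => hwΛ (hAΛ h)
            simp only [σh, hwA, if_false]
            exact hσ w hwΛ
        have e2 : σh' ∈ good c' ↔ ζ' ∈ good c' :=
          hFS.good_local c' σh' ζ' fun w hw => by
            have hwΛ := hc'Λ w hw
            have hwA : w ∉ A := fun h => hwΛ (hAΛ h)
            simp only [σh', hwA, if_false]
            exact hσ' w hwΛ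
        exact ⟨e1.2 hζg, e2.2 hζ'g⟩
  haveI := hγ.isProbability Λ ζ
  haveI := hγ.isProbability Λ ζ'
  have hindi : ∀ η, Integrable (Bad.indicator (1 : (V → S) → ℝ)) (γ Λ η) := fun η => by
    haveI := hγ.isProbability Λ η
    exact (integrable_const (1 : ℝ)).indicator hBadm
  -- inner bound: a good `σ` agreeing with `ζ` off `Λ`, against the whole of `γ_Λ(· | ζ')`
  have hinner : ∀ σ, (∀ x ∉ Λ, σ x = ζ x) → σ ∉ Bad →
      |φ σ - ∫ σ', φ σ' ∂(γ Λ ζ')| ≤ ε + (γ Λ ζ').real Bad := by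
    intro σ hσ hσB
    have hsub : ∫ σ', (φ σ - φ σ') ∂(γ Λ ζ') = φ σ - ∫ σ', φ σ' ∂(γ Λ ζ') := by
      rw [integral_sub (integrable_const _) (hφi ζ'), integral_const]
      simp
    rw [← hsub]
    calc |∫ σ', (φ σ - φ σ') ∂(γ Λ ζ')|
        ≤ ∫ σ', |φ σ - φ σ'| ∂(γ Λ ζ') := abs_integral_le_integral_abs
      _ ≤ ∫ σ', (ε + Bad.indicator (1 : (V → S) → ℝ) σ') ∂(γ Λ ζ') := by
          refine integral_mono_ae ((integrable_const _).sub (hφi ζ')).abs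
            ((integrable_const ε).add (hindi ζ')) ?_
          filter_upwards [hγ.proper Λ ζ'] with σ' hσ'
          by_cases hB : σ' ∈ Bad
          · rw [Set.indicator_of_mem hB, Pi.one_apply]
            have h1 : |φ σ - φ σ'| ≤ 1 := by
              rw [abs_sub_le_iff]
              constructor <;> linarith [(hφ01 σ).1, (hφ01 σ).2, (hφ01 σ').1, (hφ01 σ').2]
            linarith
          · rw [Set.indicator_of_notMem hB, add_zero]
            exact hkey σ σ' hσ hσ' hσB hB
      _ = ε + (γ Λ ζ').real Bad := by
          rw [integral_add (integrable_const ε) (hindi ζ'), integral_indicator_one hBadm,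
            integral_const]
          simp
  -- outer bound
  have houter : ∀ᵐ σ ∂(γ Λ ζ), |φ σ - ∫ σ', φ σ' ∂(γ Λ ζ')| ≤
      (ε + (γ Λ ζ').real Bad) + Bad.indicator (1 : (V → S) → ℝ) σ := by
    filter_upwards [hγ.proper Λ ζ] with σ hσ
    by_cases hB : σ ∈ Bad
    · rw [Set.indicator_of_mem hB, Pi.one_apply]
      obtain ⟨i0, i1⟩ := integral_mem_unitInterval (μ := γ Λ ζ') hφm hφ01
      have h1 : |φ σ - ∫ σ', φ σ' ∂(γ Λ ζ')| ≤ 1 := by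
        rw [abs_sub_le_iff]
        constructor <;> linarith [(hφ01 σ).1, (hφ01 σ).2]
      have h2 : 0 ≤ (γ Λ ζ').real Bad := measureReal_nonneg
      linarith
    · rw [Set.indicator_of_notMem hB, add_zero]
      exact hinner σ hσ hB
  rw [hres ζ, hres ζ']
  have hsub' : ∫ σ, (φ σ - ∫ σ', φ σ' ∂(γ Λ ζ')) ∂(γ Λ ζ) =
      ∫ σ, φ σ ∂(γ Λ ζ) - ∫ σ', φ σ' ∂(γ Λ ζ') := by
    rw [integral_sub (hφi ζ) (integrable_const _), integral_const]
    simp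
  calc |∫ σ, φ σ ∂(γ Λ ζ) - ∫ σ, φ σ ∂(γ Λ ζ')|
      = |∫ σ, (φ σ - ∫ σ', φ σ' ∂(γ Λ ζ')) ∂(γ Λ ζ)| := by rw [hsub']
    _ ≤ ∫ σ, |φ σ - ∫ σ', φ σ' ∂(γ Λ ζ')| ∂(γ Λ ζ) := abs_integral_le_integral_abs
    _ ≤ ∫ σ, ((ε + (γ Λ ζ').real Bad) + Bad.indicator (1 : (V → S) → ℝ) σ) ∂(γ Λ ζ) :=
        integral_mono_ae ((hφi ζ).sub (integrable_const _)).abs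
          ((integrable_const _).add (hindi ζ)) houter
    _ = (ε + (γ Λ ζ').real Bad) + (γ Λ ζ).real Bad := by
        rw [integral_add (integrable_const _) (hindi ζ), integral_indicator_one hBadm,
          integral_const]
        simp
    _ = ε + (γ Λ ζ).real Bad + (γ Λ ζ').real Bad := by ring

/-- **Exponential decay of boundary influence in the pure case** (Dobrushin–Shlosman 1985 /
van den Berg–Maes 1994 block recursion, sup form; the mechanism behind the engine's threshold
`2 ε₀ · shellCount d n ≤ 1`): let `γ` satisfy the good-exterior condition at `(n, ε)` with NO bad
configurations and have exact range `2n+1` (`HasLeak … n 0 r`). If two boundary conditions agree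
off `Λ` on the ball of radius `2n + k(2n+1)` around `x`, then for every `[0,1]`-valued
cell-`x`-local `g`, `|γ_Λ g(ζ) - γ_Λ g(ζ')| ≤ ε (ε · shellCount d n)^k`.
Step `k → k+1`: resample `A = Λ ∩ cube(x)`; by exact range and blindness the block expectation
is `H ∘ P` with `P` the projection onto the shell cells inside `Λ`; by `fs` all values of `H ∘ P`
lie in an interval `[lo, lo + ε]` (`lo` an infimum), so `H ∘ P = lo + ε·H̃` with `H̃ ∈ [0,1]`
an observable of the `≤ shellCount d n` shell cells, each at distance `2n+1` from `x`
(`cdist_triangle` moves the ball), and `multiCell_influence` with the induction hypothesis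
bounds its influence by `shellCount d n · ε (ε·shellCount d n)^k`.
[cite: DobrushinShlosman1985, §2] -/
theorem pure_influence_decay [Fintype V] {cell : V → CoarseIdx μc}
    {γ : Specification V S} (hγ : IsSpecification γ) {good : CoarseIdx μc → Set (V → S)}
    {n : ℕ} {ε r : ℝ} (hε : 0 ≤ ε) (hFS : IsGoodFS cell γ good n ε) (hall : ∀ c σ, σ ∈ good c)
    (hrange : HasLeak cell γ n 0 r) (hμ : ∀ i, 4 * n + 3 ≤ μc i + 1) (k : ℕ) :
    ∀ (Λ : Finset V), (∀ v w, cell v = cell w → v ∈ Λ → w ∈ Λ) →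
      ∀ (x : CoarseIdx μc) (g : (V → S) → ℝ), Measurable g → (∀ σ, 0 ≤ g σ ∧ g σ ≤ 1) →
      DependsOn g {v | cell v = x} →
      ∀ ζ ζ' : V → S, (∀ v, v ∉ Λ → cdist x (cell v) ≤ 2 * n + k * (2 * n + 1) → ζ v = ζ' v) →
        |∫ σ, g σ ∂(γ Λ ζ) - ∫ σ, g σ ∂(γ Λ ζ')| ≤ ε * (ε * shellCount d n) ^ k := by
  classical
  induction k with
  | zero =>
    intro Λ hΛ x g hgm hg01 hgdep ζ ζ' hagree
    have h := fs_base_step hγ hε hFS x Λ hΛ ζ ζ' (fun v hv hd => hagree v hv (by omega))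
      (fun c' _ _ => ⟨hall c' ζ, hall c' ζ'⟩) hgm hg01 hgdep
    have hempty : {σ : V → S | ∃ c', cdist x c' = 2 * n + 1 ∧ (∃ v ∈ Λ, cell v = c') ∧
        σ ∉ good c'} = ∅ := by
      ext σ
      simp only [Set.mem_setOf_eq, Set.mem_empty_iff_false, iff_false]
      rintro ⟨c', -, -, hng⟩
      exact hng (hall c' σ)
    rw [hempty] at h
    simpa using h
  | succ k IH =>
    intro Λ hΛ x g hgm hg01 hgdep ζ ζ' hagree
    have hg1 : ∀ σ, |g σ| ≤ 1 := fun σ => by rw [abs_of_nonneg (hg01 σ).1]; exact (hg01 σ).2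
    have hrad : 2 * n + 1 ≤ 2 * n + (k + 1) * (2 * n + 1) := by nlinarith
    -- the block `A = Λ ∩ cube(x, 2n)` and the shell cells
    set A : Finset V := Λ.filter fun v => cdist x (cell v) ≤ 2 * n with hA
    have hAΛ : A ⊆ Λ := Finset.filter_subset _ _
    have hAcube : ∀ v ∈ A, cdist x (cell v) ≤ 2 * n := fun v hv => (Finset.mem_filter.1 hv).2
    have hAunion : ∀ v w, cell v = cell w → v ∈ A → w ∈ A := fun v w hvw hv => by
      rw [hA, Finset.mem_filter] at hv ⊢
      exact ⟨hΛ v w hvw hv.1, hvw ▸ hv.2⟩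
    set Y : Finset (CoarseIdx μc) := Finset.univ.filter fun c' => cdist x c' = 2 * n + 1 with hY
    have hYcard : (Y.card : ℝ) ≤ shellCount d n := by
      exact_mod_cast card_shell_le_shellCount x n hμ
    -- the projection onto the shell cells inside `Λ` (everything else frozen at `ζ`)
    let P : (V → S) → (V → S) := fun σ v =>
      if v ∈ Λ ∧ cdist x (cell v) = 2 * n + 1 then σ v else ζ v
    have hPm : Measurable P := by
      refine measurable_pi_iff.2 fun v => ?_
      by_cases hv : v ∈ Λ ∧ cdist x (cell v) = 2 * n + 1
      · simp only [P, hv, and_self, if_true]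
        exact measurable_pi_apply v
      · simp only [P, hv, if_false]
        exact measurable_const
    set Hf : (V → S) → ℝ := fun σ => ∫ τ, g τ ∂(γ A (P σ)) with hHf
    have hHfm : Measurable Hf := (DobrushinShlosman.measurable_windowAvg' hγ A hgm).comp hPm
    have hHf01 : ∀ σ, 0 ≤ Hf σ ∧ Hf σ ≤ 1 := fun σ => by
      haveI := hγ.isProbability A (P σ)
      exact integral_mem_unitInterval hgm hg01
    have hHfdep : DependsOn Hf {v | cell v ∈ Y} := by
      intro σ σ' h
      simp only [hHf]
      have hP : P σ = P σ' := funext fun v => by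
        by_cases hc : v ∈ Λ ∧ cdist x (cell v) = 2 * n + 1
        · simp only [P, hc, and_self, if_true]
          exact h v (by
            show cell v ∈ Y
            rw [hY, Finset.mem_filter]
            exact ⟨Finset.mem_univ _, hc.2⟩)
        · simp only [P, hc, if_false]
      rw [hP]
    -- FS: all values of `Hf` lie within `ε` of each other
    have hosc : ∀ σ₁ σ₂, |Hf σ₁ - Hf σ₂| ≤ ε := by
      intro σ₁ σ₂
      refine hFS.fs x A hAcube hAunion (P σ₁) (P σ₂) ?_ ?_ g hgm hg01 hgdep
      · intro v hv
        have hc : ¬ (v ∈ Λ ∧ cdist x (cell v) = 2 * n + 1) := fun h => by omega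
        simp only [P, hc, if_false]
      · intro c' _ _
        exact ⟨hall _ _, hall _ _⟩
    -- exact range + blindness: the block expectation only reads the cells within `2n+1`, off `A`
    have hrangeA : ∀ σ σ' : V → S, (∀ v, cdist x (cell v) ≤ 2 * n + 1 → v ∉ A → σ v = σ' v) →
        ∫ τ, g τ ∂(γ A σ) = ∫ τ, g τ ∂(γ A σ') := by
      intro σ σ' h
      let σ₁ : V → S := fun v => if v ∈ A then σ' v else σ v
      have e1 : γ A σ = γ A σ₁ :=
        DobrushinShlosman.spec_apply_congr hγ A fun v hv => by simp only [σ₁, hv, if_false]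
      have e2 := hrange x A hAcube hAunion 0 σ₁ σ' (fun v hd => by
        by_cases hvA : v ∈ A
        · simp only [σ₁, hvA, if_true]
        · simp only [σ₁, hvA, if_false]
          exact h v (by simpa using hd) hvA) g hgm hg01 hgdep
      rw [e1]
      have h0 : |∫ τ, g τ ∂(γ A σ₁) - ∫ τ, g τ ∂(γ A σ')| ≤ 0 := e2.trans (by simp)
      exact sub_eq_zero.1 (abs_nonpos_iff.1 h0)
    have hμeq : ∀ (η : V → S), (∀ v, v ∉ Λ → cdist x (cell v) ≤ 2 * n + 1 → η v = ζ v) →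
        ∫ σ, g σ ∂(γ Λ η) = ∫ σ, Hf σ ∂(γ Λ η) := by
      intro η hη
      rw [← kernel_integral_integral_eq_of_subset hγ hAΛ η hgm hg1]
      refine integral_congr_ae ?_
      filter_upwards [hγ.proper Λ η] with σ hσ
      refine hrangeA σ (P σ) fun v hd hvA => ?_
      by_cases hvΛ : v ∈ Λ
      · have hdeq : cdist x (cell v) = 2 * n + 1 := by
          have : ¬ cdist x (cell v) ≤ 2 * n := fun hle => hvA (Finset.mem_filter.2 ⟨hvΛ, hle⟩)
          omega
        simp only [P, hvΛ, hdeq, and_self, if_true]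
      · have hc : ¬ (v ∈ Λ ∧ cdist x (cell v) = 2 * n + 1) := fun h => hvΛ h.1
        simp only [P, hc, if_false]
        rw [hσ v hvΛ]
        exact hη v hvΛ hd
    have hζeq := hμeq ζ fun v _ _ => rfl
    have hζ'eq := hμeq ζ' fun v hv hd => (hagree v hv (hd.trans hrad)).symm
    rw [hζeq, hζ'eq]
    haveI := hγ.isProbability Λ ζ
    haveI := hγ.isProbability Λ ζ'
    have hRHS : 0 ≤ ε * (ε * shellCount d n) ^ (k + 1) := by positivity
    rcases hε.eq_or_lt with hε0 | hεpos
    · -- `ε = 0`: the block expectation is constant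
      have hc : ∀ σ, Hf σ = Hf ζ := fun σ => by
        have h := hosc σ ζ
        rw [← hε0] at h
        exact sub_eq_zero.1 (abs_nonpos_iff.1 h)
      have hH : Hf = fun _ => Hf ζ := funext hc
      rw [hH]
      simp only [integral_const, probReal_univ, smul_eq_mul, one_mul, sub_self, abs_zero]
      exact hRHS
    · -- `ε > 0`: normalise to `[0,1]` and apply the multi-cell lemma with the induction hypothesis
      haveI : Nonempty (V → S) := ⟨ζ⟩
      set lo : ℝ := ⨅ σ, Hf σ with hlo
      have hbdd : BddBelow (Set.range Hf) := ⟨0, by rintro _ ⟨σ, rfl⟩; exact (hHf01 σ).1⟩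
      have hlo1 : ∀ σ, lo ≤ Hf σ := fun σ => ciInf_le hbdd σ
      have hlo2 : ∀ σ, Hf σ ≤ lo + ε := fun σ => by
        have h : Hf σ - ε ≤ lo := le_ciInf fun σ₂ => by
          have h2 := abs_sub_le_iff.1 (hosc σ σ₂)
          linarith [h2.1]
        linarith
      set Ht : (V → S) → ℝ := fun σ => (Hf σ - lo) / ε with hHt
      have hHtm : Measurable Ht := (hHfm.sub_const lo).div_const ε
      have hHt01 : ∀ σ, 0 ≤ Ht σ ∧ Ht σ ≤ 1 := fun σ =>
        ⟨div_nonneg (by linarith [hlo1 σ]) hε, (div_le_one hεpos).2 (by linarith [hlo2 σ])⟩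
      have hHtdep : DependsOn Ht {v | cell v ∈ Y} := fun σ σ' h => by
        simp only [hHt, hHfdep h]
      have hM := multiCell_influence hγ (ρ := 2 * n + k * (2 * n + 1))
        (δ := ε * (ε * shellCount d n) ^ k) IH Y Λ hΛ Ht hHtm hHt01 hHtdep ζ ζ' (by
          intro y hy v hv hd
          apply hagree v hv
          have hxy : cdist x y = 2 * n + 1 := (Finset.mem_filter.1 hy).2
          have ht := cdist_triangle x y (cell v)
          rw [hxy] at ht
          have e : (k + 1) * (2 * n + 1) = k * (2 * n + 1) + (2 * n + 1) := by ring
          rw [e]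
          omega)
      have hHti : ∀ η, Integrable Ht (γ Λ η) := fun η => by
        haveI := hγ.isProbability Λ η
        exact DobrushinMetric.integrable_of_abs_le' hHtm (M := 1) fun σ => by
          rw [abs_of_nonneg (hHt01 σ).1]; exact (hHt01 σ).2
      have hlin : ∀ η : V → S, ∫ σ, Hf σ ∂(γ Λ η) = lo + ε * ∫ σ, Ht σ ∂(γ Λ η) := by
        intro η
        haveI := hγ.isProbability Λ η
        have hH : Hf = fun σ => lo + ε * Ht σ := funext fun σ => by
          simp only [hHt]
          field_simp
          ring
        rw [hH, integral_add (integrable_const lo) ((hHti η).const_mul ε), integral_const,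
          integral_const_mul]
        simp
      rw [hlin ζ, hlin ζ']
      calc |lo + ε * ∫ σ, Ht σ ∂(γ Λ ζ) - (lo + ε * ∫ σ, Ht σ ∂(γ Λ ζ'))|
          = ε * |∫ σ, Ht σ ∂(γ Λ ζ) - ∫ σ, Ht σ ∂(γ Λ ζ')| := by
            rw [add_sub_add_left_eq_sub, ← mul_sub, abs_mul, abs_of_pos hεpos]
        _ ≤ ε * (Y.card * (ε * (ε * shellCount d n) ^ k)) := mul_le_mul_of_nonneg_left hM hε
        _ ≤ ε * (shellCount d n * (ε * (ε * shellCount d n) ^ k)) := by gcongr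
        _ = ε * (ε * shellCount d n) ^ (k + 1) := by ring


end Literature.Probability.LatticeModels
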